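import Mathlib
import Summits.CriticalPhenomena.Ising3DConformalLimit.Theses.HarmonicMomentsIsotropy
import Literature.Probability.LatticeModels.MessagerMiracleSoleFree
import HarnessLib

/-!
# Route HarmonicMomentsIsotropy — `HarmonicDilution` off the cubic-invariant sector

Item `stmt-CriticalPhenomena-6034` (`HarmonicDilution`) asks that every anisotropy ratio
`a_{Y,m}(β) = ∑_x Y(x)|x|^{2m}G_β(x) / ∑_x |x|^{n+2m}G_β(x)` (`G_β = ⟨σ₀σ_x⟩^∅_β` on `ℤ³`,
`Y` homogeneous of degree `n ≥ 1` and harmonic) tends to `0` as `β ↑ β_c`.  This file proves the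
part of it that lattice symmetry gives for free, unconditionally: if the hyperoctahedral
symmetrisation of `Y` over some nonempty finite family `T` of lattice symmetries `(π, ε)`
(signed coordinate permutations) vanishes, `∑_{(π,ε) ∈ T} Y(ε · (v ∘ π⁻¹)) = 0` for all `v`, then the harmonic moment
`k_{Y,m}(β) = ∑'_x Y(x)|x|^{2m}G_β(x)` is identically `0` for every `β` (`harmonicMoment_eq_zero_of_symmetrization`;
no summability input is needed: a non-summable family has `∑' = 0` by convention),
so `a_{Y,m} → 0` trivially (`harmonicDilution_of_symmetrization_eq_zero`); in particular for every
`Y` of odd degree (`harmonicDilution_odd`, `T = {id, -id}`) and for harmonic quadratics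
(`harmonicDilution_of_degree_two`, full group: the sign sum kills mixed monomials, the permutation
sum turns `∑ⱼ cⱼwⱼ²` into `(∑ⱼ cⱼ)·A`, and `ΔY = 0` is `∑ⱼ cⱼ = 0`); together
`harmonicDilution_of_degree_le_three`, and the route decl reduces to the even degrees `n ≥ 4`
(`harmonicDilution_iff_even_four_le`).  The genuine (open) content of the item is
thus confined to the `O_h`-invariant harmonics (`K₄ = ∑ xᵢ⁴ - (3/5)|x|⁴`, degrees 4, 6, 8, …), as
recorded on the item by the grounder/refuter.

Inputs: invariance of the free two-point function under signed coordinate permutations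
(`twoPointFree_signedPerm`, Friedli–Velenik Exercise 3.14, valid for every `β`) and reindexing of
`tsum` along the equivalence `Site.signedPerm π ε`; the degree-two case is a finite computation with
`MvPolynomial.coeff_pderiv`.
-/

namespace Summit.CriticalPhenomena.Ising3DConformalLimit.Theorems

open Filter Topology Set
open Literature.Probability.LatticeModels
open Summit.CriticalPhenomena.Ising3DConformalLimit.Theses.HarmonicMomentsIsotropy

/-- Homogeneity under scaling of the argument: `Y(c v) = c^n Y(v)` for `Y` homogeneous of
degree `n`. -/
theorem eval_smul_of_isHomogeneous {σ : Type*} (Y : MvPolynomial σ ℝ) {n : ℕ}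
    (hY : Y.IsHomogeneous n) (c : ℝ) (v : σ → ℝ) :
    MvPolynomial.eval (fun i => c * v i) Y = c ^ n * MvPolynomial.eval v Y := by
  rw [MvPolynomial.eval_eq, MvPolynomial.eval_eq, Finset.mul_sum]
  refine Finset.sum_congr rfl fun d hd => ?_
  have hprod : ∏ i ∈ d.support, (c * v i) ^ d i = c ^ n * ∏ i ∈ d.support, v i ^ d i := by
    simp_rw [mul_pow]
    rw [Finset.prod_mul_distrib, Finset.prod_pow_eq_pow_sum, ← hY.degree_eq_sum_deg_support hd]
  rw [hprod]; ring

/-- The Euclidean norm on `ℤ³` is invariant under signed coordinate permutations. -/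
theorem euclid_signedPerm (π : Equiv.Perm (Fin 3)) (ε : Fin 3 → ℤˣ) (x : Site 3) :
    Real.sqrt (∑ j, ((Site.signedPerm π ε x j : ℤ) : ℝ) ^ 2) =
      Real.sqrt (∑ j, ((x j : ℤ) : ℝ) ^ 2) := by
  congr 1
  have h : ∀ j, ((Site.signedPerm π ε x j : ℤ) : ℝ) ^ 2 = ((x (π.symm j) : ℤ) : ℝ) ^ 2 := by
    intro j
    rw [Site.signedPerm_apply, Int.cast_mul]
    rcases Int.units_eq_one_or (ε j) with hε | hε <;> simp [hε]
  simp_rw [h]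
  exact Equiv.sum_comp π.symm (fun j => ((x j : ℤ) : ℝ) ^ 2)

/-- **Vanishing of the harmonic moment off the invariant sector.**  If, for some nonempty finite
family `T` of lattice symmetries `g = (π, ε)` (signed coordinate permutations), the symmetrisation
`∑_{g ∈ T} Y(g·v)` of a polynomial `Y` vanishes identically, then
`k_{Y,m}(β) = ∑'_x Y(x)|x|^{2m}⟨σ₀σ_x⟩^∅_β = 0` for every `β`: if the family is summable, reindex
the sum along each symmetry (which fixes `|x|` and `⟨σ₀σ_x⟩`) and average over `T`; otherwise the
`tsum` is `0` by convention. -/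
theorem harmonicMoment_eq_zero_of_symmetrization (β : ℝ) (Y : MvPolynomial (Fin 3) ℝ)
    {T : Finset (Equiv.Perm (Fin 3) × (Fin 3 → ℤˣ))} (hT : T.Nonempty)
    (hsym : ∀ v : Fin 3 → ℝ,
      ∑ g ∈ T, MvPolynomial.eval (fun i => ((g.2 i : ℤ) : ℝ) * v (g.1.symm i)) Y = 0) (m : ℕ) :
    ∑' x : Site 3, MvPolynomial.eval (fun i => ((x i : ℤ) : ℝ)) Y *
        Real.sqrt (∑ j, ((x j : ℤ) : ℝ) ^ 2) ^ (2 * m) * twoPointFree 3 β x = 0 := by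
  set nE : Site 3 → ℝ := fun x => Real.sqrt (∑ j, ((x j : ℤ) : ℝ) ^ 2) with hnE
  set f : Site 3 → ℝ := fun x => MvPolynomial.eval (fun i => ((x i : ℤ) : ℝ)) Y *
    nE x ^ (2 * m) * twoPointFree 3 β x with hf
  by_cases hfs : Summable f
  swap
  · exact tsum_eq_zero_of_not_summable hfs
  -- the transformed summands
  set F : Equiv.Perm (Fin 3) × (Fin 3 → ℤˣ) → Site 3 → ℝ := fun g x =>
    MvPolynomial.eval (fun i => ((g.2 i : ℤ) : ℝ) * ((x (g.1.symm i) : ℤ) : ℝ)) Y *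
      nE x ^ (2 * m) * twoPointFree 3 β x with hF
  have hpt : ∀ (g : Equiv.Perm (Fin 3) × (Fin 3 → ℤˣ)) (x : Site 3),
      f (Site.signedPerm g.1 g.2 x) = F g x := by
    intro g x
    have harg : (fun i => ((Site.signedPerm g.1 g.2 x i : ℤ) : ℝ)) =
        fun i => ((g.2 i : ℤ) : ℝ) * ((x (g.1.symm i) : ℤ) : ℝ) := by
      funext i
      rw [Site.signedPerm_apply, Int.cast_mul]
    simp only [hf, hF, hnE]
    rw [twoPointFree_signedPerm, euclid_signedPerm, harg]
  have hFs : ∀ g : Equiv.Perm (Fin 3) × (Fin 3 → ℤˣ), Summable (F g) := fun g =>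
    ((Equiv.summable_iff (Site.signedPerm g.1 g.2)).2 hfs).congr (hpt g)
  have hinv : ∀ g : Equiv.Perm (Fin 3) × (Fin 3 → ℤˣ), ∑' x, F g x = ∑' x, f x := by
    intro g
    calc ∑' x, F g x = ∑' x, f (Site.signedPerm g.1 g.2 x) := tsum_congr fun x => (hpt g x).symm
      _ = ∑' x, f x := Equiv.tsum_eq _ _
  -- average over `T`
  have hswap : ∑' x, ∑ g ∈ T, F g x = ∑ g ∈ T, ∑' x, F g x :=
    Summable.tsum_finsetSum (fun g _ => hFs g)
  have hzero : ∑' x, ∑ g ∈ T, F g x = 0 := by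
    refine (tsum_congr fun x => ?_).trans tsum_zero
    simp only [hF]
    rw [← Finset.sum_mul, ← Finset.sum_mul, hsym (fun j => ((x j : ℤ) : ℝ)), zero_mul, zero_mul]
  have hcard : ∑ g ∈ T, ∑' x, F g x = (T.card : ℝ) * ∑' x, f x := by
    simp_rw [hinv]
    rw [Finset.sum_const, nsmul_eq_mul]
  have hpos : (0 : ℝ) < (T.card : ℝ) := by exact_mod_cast hT.card_pos
  have hmain : (T.card : ℝ) * ∑' x, f x = 0 := by rw [← hcard, ← hswap, hzero]
  rcases mul_eq_zero.1 hmain with h | h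
  · exact absurd h hpos.ne'
  · exact h

/-- **`HarmonicDilution` off the invariant sector (unconditional).**  For a polynomial `Y` whose
symmetrisation over some nonempty finite family of lattice symmetries vanishes, the anisotropy
ratio `a_{Y,m}(β) = k_{Y,m}(β) / M_{n+2m}(β)` is identically `0`, hence tends to `0` as
`β ↑ β_c(3)` — the conclusion of `HarmonicDilution` for this `(n, m, Y)` (neither harmonicity nor
homogeneity is needed). -/
theorem harmonicDilution_of_symmetrization_eq_zero (n m : ℕ) (Y : MvPolynomial (Fin 3) ℝ)
    {T : Finset (Equiv.Perm (Fin 3) × (Fin 3 → ℤˣ))} (hT : T.Nonempty)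
    (hsym : ∀ v : Fin 3 → ℝ,
      ∑ g ∈ T, MvPolynomial.eval (fun i => ((g.2 i : ℤ) : ℝ) * v (g.1.symm i)) Y = 0) :
    Tendsto (fun β => (∑' x : Site 3, MvPolynomial.eval (fun i => ((x i : ℤ) : ℝ)) Y *
          Real.sqrt (∑ i, ((x i : ℤ) : ℝ) ^ 2) ^ (2 * m) * twoPointFree 3 β x) /
        (∑' x : Site 3, Real.sqrt (∑ i, ((x i : ℤ) : ℝ) ^ 2) ^ (n + 2 * m) * twoPointFree 3 β x))
      (𝓝[<] criticalBeta 3) (𝓝 0) := by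
  have h : (fun β => (∑' x : Site 3, MvPolynomial.eval (fun i => ((x i : ℤ) : ℝ)) Y *
          Real.sqrt (∑ i, ((x i : ℤ) : ℝ) ^ 2) ^ (2 * m) * twoPointFree 3 β x) /
        (∑' x : Site 3, Real.sqrt (∑ i, ((x i : ℤ) : ℝ) ^ 2) ^ (n + 2 * m) * twoPointFree 3 β x))
      = fun _ => 0 := by
    funext β
    rw [harmonicMoment_eq_zero_of_symmetrization β Y hT hsym m, zero_div]
  rw [h]
  exact tendsto_const_nhds

/-- Odd degree: the symmetrisation over `{id, -id}` vanishes (`Y(-v) = -Y(v)`). -/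
theorem symmetrization_eq_zero_of_odd {n : ℕ} (hn : Odd n) (Y : MvPolynomial (Fin 3) ℝ)
    (hY : Y.IsHomogeneous n) (v : Fin 3 → ℝ) :
    ∑ g ∈ ({((1 : Equiv.Perm (Fin 3)), (1 : Fin 3 → ℤˣ)), (1, -1)} :
        Finset (Equiv.Perm (Fin 3) × (Fin 3 → ℤˣ))),
      MvPolynomial.eval (fun i => ((g.2 i : ℤ) : ℝ) * v (g.1.symm i)) Y = 0 := by
  have hne : ((1 : Equiv.Perm (Fin 3)), (1 : Fin 3 → ℤˣ)) ≠ (1, -1) := by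
    intro h
    have h2 := congrArg (fun p : Equiv.Perm (Fin 3) × (Fin 3 → ℤˣ) => p.2 0) h
    exact absurd h2 (by decide)
  rw [Finset.sum_pair hne]
  have h1 : (fun i => ((((1 : Fin 3 → ℤˣ) i : ℤˣ) : ℤ) : ℝ) * v ((1 : Equiv.Perm (Fin 3)).symm i))
      = fun i => (1 : ℝ) * v i := by
    funext i; simp [Equiv.Perm.one_def]
  have h2 : (fun i => ((((-1 : Fin 3 → ℤˣ) i : ℤˣ) : ℤ) : ℝ) * v ((1 : Equiv.Perm (Fin 3)).symm i))
      = fun i => (-1 : ℝ) * v i := by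
    funext i; simp [Equiv.Perm.one_def]
  simp only []
  rw [h1, h2, eval_smul_of_isHomogeneous Y hY, eval_smul_of_isHomogeneous Y hY, one_pow,
    hn.neg_one_pow]
  ring

/-- **`HarmonicDilution` in odd degree (unconditional).**  For every homogeneous `Y` of odd
degree `n` and every `m`, `a_{Y,m}(β) → 0` as `β ↑ β_c(3)` (indeed `k_{Y,m} ≡ 0` by
`x ↦ -x`). -/
theorem harmonicDilution_odd (n m : ℕ) (Y : MvPolynomial (Fin 3) ℝ) (hn : Odd n)
    (hY : Y.IsHomogeneous n) :
    Tendsto (fun β => (∑' x : Site 3, MvPolynomial.eval (fun i => ((x i : ℤ) : ℝ)) Y *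
          Real.sqrt (∑ i, ((x i : ℤ) : ℝ) ^ 2) ^ (2 * m) * twoPointFree 3 β x) /
        (∑' x : Site 3, Real.sqrt (∑ i, ((x i : ℤ) : ℝ) ^ 2) ^ (n + 2 * m) * twoPointFree 3 β x))
      (𝓝[<] criticalBeta 3) (𝓝 0) :=
  harmonicDilution_of_symmetrization_eq_zero n m Y (Finset.insert_nonempty _ _)
    (symmetrization_eq_zero_of_odd hn Y hY)

/-! ### Degree two: sign sums of quadratic monomials and the Laplacian -/

/-- `∑_{u ∈ ℤˣ} f(u) = f(1) + f(-1)`. -/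
theorem sum_units_int (f : ℤˣ → ℝ) : ∑ u : ℤˣ, f u = f 1 + f (-1) := by
  have h : (Finset.univ : Finset ℤˣ) = {1, -1} := rfl
  rw [h, Finset.sum_pair (by decide)]

/-- Summing a monomial over the sign group factorises:
`∑_ε ∏ᵢ (εᵢ wᵢ)^{dᵢ} = ∏ᵢ (wᵢ^{dᵢ} + (-wᵢ)^{dᵢ})`. -/
theorem sum_signs_prod_pow (d : Fin 3 →₀ ℕ) (w : Fin 3 → ℝ) :
    ∑ ε : Fin 3 → ℤˣ, ∏ i, (((ε i : ℤ) : ℝ) * w i) ^ d i =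
      ∏ i : Fin 3, (w i ^ d i + (-w i) ^ d i) := by
  rw [← Fintype.piFinset_univ,
    Finset.sum_prod_piFinset _ (fun i (u : ℤˣ) => (((u : ℤ) : ℝ) * w i) ^ d i)]
  refine Finset.prod_congr rfl fun i _ => ?_
  rw [sum_units_int]
  simp

/-- Summing a polynomial over the sign group, coefficientwise. -/
theorem sum_signs_eval (Y : MvPolynomial (Fin 3) ℝ) (w : Fin 3 → ℝ) :
    ∑ ε : Fin 3 → ℤˣ, MvPolynomial.eval (fun i => ((ε i : ℤ) : ℝ) * w i) Y =
      ∑ d ∈ Y.support, Y.coeff d * ∏ i : Fin 3, (w i ^ d i + (-w i) ^ d i) := by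
  simp_rw [MvPolynomial.eval_eq']
  rw [Finset.sum_comm]
  refine Finset.sum_congr rfl fun d _ => ?_
  rw [← Finset.mul_sum, sum_signs_prod_pow]

/-- The sign sums of the six quadratic monomials in three variables. -/
theorem prod_signs_of_sum_two {a b c : ℕ} (h : a + b + c = 2) (x y z : ℝ) :
    (x ^ a + (-x) ^ a) * (y ^ b + (-y) ^ b) * (z ^ c + (-z) ^ c) =
      8 * ((if a = 2 then x ^ 2 else 0) + (if b = 2 then y ^ 2 else 0) +
        (if c = 2 then z ^ 2 else 0)) := by
  have ha : a ≤ 2 := by omega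
  have hb : b ≤ 2 := by omega
  have hc : c ≤ 2 := by omega
  interval_cases a <;> interval_cases b <;> interval_cases c <;> first | omega | (simp <;> ring)

/-- A degree-two exponent vector with an entry `2` is `2 eⱼ`. -/
theorem eq_single_two_iff {d : Fin 3 →₀ ℕ} (hd : d 0 + d 1 + d 2 = 2) (j : Fin 3) :
    d = Finsupp.single j 2 ↔ d j = 2 := by
  constructor
  · rintro rfl; exact Finsupp.single_eq_same
  · intro hj
    ext i
    by_cases hij : i = j
    · subst hij; rw [Finsupp.single_eq_same, hj]
    · rw [Finsupp.single_eq_of_ne hij]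
      fin_cases j <;> fin_cases i <;> simp at hij hj ⊢ <;> omega

/-- For `Y` homogeneous of degree `2`: `∑_ε Y(ε w) = 8 ∑ⱼ coeff_{2eⱼ}(Y) wⱼ²`. -/
theorem sum_signs_eval_of_degree_two (Y : MvPolynomial (Fin 3) ℝ) (hY : Y.IsHomogeneous 2)
    (w : Fin 3 → ℝ) :
    ∑ ε : Fin 3 → ℤˣ, MvPolynomial.eval (fun i => ((ε i : ℤ) : ℝ) * w i) Y =
      8 * ∑ j : Fin 3, Y.coeff (Finsupp.single j 2) * w j ^ 2 := by
  rw [sum_signs_eval]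
  have hdeg : ∀ d ∈ Y.support, d 0 + d 1 + d 2 = 2 := by
    intro d hd
    have h := hY.degree_eq_sum_deg_support hd
    rw [← Finsupp.degree_apply, Finsupp.degree_eq_sum, Fin.sum_univ_three] at h
    omega
  have hG : ∀ d ∈ Y.support, ∏ i : Fin 3, (w i ^ d i + (-w i) ^ d i) =
      8 * ∑ j : Fin 3, (if d = Finsupp.single j 2 then w j ^ 2 else 0) := by
    intro d hd
    rw [Fin.prod_univ_three, Fin.sum_univ_three, prod_signs_of_sum_two (hdeg d hd)]
    simp only [eq_single_two_iff (hdeg d hd)]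
  rw [Finset.sum_congr rfl fun d hd => by rw [hG d hd]]
  calc ∑ d ∈ Y.support, Y.coeff d * (8 * ∑ j : Fin 3, (if d = Finsupp.single j 2 then w j ^ 2 else 0))
      = ∑ d ∈ Y.support, ∑ j : Fin 3,
          8 * (if d = Finsupp.single j 2 then Y.coeff d * w j ^ 2 else 0) := by
        refine Finset.sum_congr rfl fun d _ => ?_
        rw [Finset.mul_sum, Finset.mul_sum]
        refine Finset.sum_congr rfl fun j _ => ?_
        split_ifs <;> ring
    _ = 8 * ∑ j : Fin 3, ∑ d ∈ Y.support,
          (if d = Finsupp.single j 2 then Y.coeff d * w j ^ 2 else 0) := by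
        rw [Finset.sum_comm, Finset.mul_sum]
        refine Finset.sum_congr rfl fun j _ => ?_
        rw [Finset.mul_sum]
    _ = 8 * ∑ j : Fin 3, Y.coeff (Finsupp.single j 2) * w j ^ 2 := by
        congr 1
        refine Finset.sum_congr rfl fun j _ => ?_
        rw [Finset.sum_ite_eq']
        split_ifs with h
        · rfl
        · rw [MvPolynomial.notMem_support_iff.1 h, zero_mul]

/-- Degree two, harmonic: the full hyperoctahedral symmetrisation vanishes
(`∑_ε` kills the mixed monomials, `∑_π` turns `∑ⱼ cⱼ wⱼ²` into `(tr c)|w|²/…`, and the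
Laplacian condition is `tr c = 0`). -/
theorem symmetrization_eq_zero_of_degree_two (Y : MvPolynomial (Fin 3) ℝ)
    (hY : Y.IsHomogeneous 2)
    (hΔ : ∑ i : Fin 3, MvPolynomial.pderiv i (MvPolynomial.pderiv i Y) = 0) (v : Fin 3 → ℝ) :
    ∑ g ∈ (Finset.univ : Finset (Equiv.Perm (Fin 3) × (Fin 3 → ℤˣ))),
      MvPolynomial.eval (fun i => ((g.2 i : ℤ) : ℝ) * v (g.1.symm i)) Y = 0 := by
  -- the trace condition from the Laplacian
  have htr : ∑ j : Fin 3, Y.coeff (Finsupp.single j 2) = 0 := by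
    have h := congrArg (MvPolynomial.coeff 0) hΔ
    rw [MvPolynomial.coeff_sum, MvPolynomial.coeff_zero] at h
    have h2 : ∀ i : Fin 3, MvPolynomial.coeff 0 (MvPolynomial.pderiv i (MvPolynomial.pderiv i Y))
        = Y.coeff (Finsupp.single i 2) * 2 := by
      intro i
      rw [MvPolynomial.coeff_pderiv, MvPolynomial.coeff_pderiv, zero_add, ← Finsupp.single_add,
        Finsupp.single_eq_same]
      norm_num
    simp_rw [h2] at h
    rw [← Finset.sum_mul] at h
    linarith
  rw [Fintype.sum_prod_type]
  simp only []
  have hP : ∀ π : Equiv.Perm (Fin 3),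
      ∑ ε : Fin 3 → ℤˣ, MvPolynomial.eval (fun i => ((ε i : ℤ) : ℝ) * v (π.symm i)) Y =
        8 * ∑ j : Fin 3, Y.coeff (Finsupp.single j 2) * v (π.symm j) ^ 2 := fun π =>
    sum_signs_eval_of_degree_two Y hY (fun i => v (π.symm i))
  rw [Finset.sum_congr rfl fun π _ => hP π, ← Finset.mul_sum, Finset.sum_comm]
  have hA : ∀ j : Fin 3, ∑ π : Equiv.Perm (Fin 3), v (π.symm j) ^ 2 =
      ∑ π : Equiv.Perm (Fin 3), v (π.symm 0) ^ 2 := by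
    intro j
    rw [← Equiv.sum_comp (Equiv.mulLeft (Equiv.swap (0 : Fin 3) j)) (fun π => v (π.symm 0) ^ 2)]
    refine Finset.sum_congr rfl fun π _ => ?_
    simp [Equiv.Perm.mul_def, Equiv.swap_apply_left]
  have hfac : ∑ j : Fin 3, ∑ π : Equiv.Perm (Fin 3), Y.coeff (Finsupp.single j 2) * v (π.symm j) ^ 2
      = (∑ j : Fin 3, Y.coeff (Finsupp.single j 2)) *
          ∑ π : Equiv.Perm (Fin 3), v (π.symm 0) ^ 2 := by
    rw [Finset.sum_mul]
    refine Finset.sum_congr rfl fun j _ => ?_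
    rw [← Finset.mul_sum, hA j]
  rw [hfac, htr, zero_mul, mul_zero]

/-- **`HarmonicDilution` in degree two (unconditional).**  For every harmonic homogeneous
quadratic `Y` (`∑ᵢ ∂ᵢ²Y = 0`) and every `m`, `a_{Y,m}(β) → 0` as `β ↑ β_c(3)` (indeed
`k_{Y,m} ≡ 0`: the hyperoctahedral average of `Y` is `(16/2)·tr(Hess Y)/… · |v|² = 0`). -/
theorem harmonicDilution_of_degree_two (m : ℕ) (Y : MvPolynomial (Fin 3) ℝ)
    (hY : Y.IsHomogeneous 2)
    (hΔ : ∑ i : Fin 3, MvPolynomial.pderiv i (MvPolynomial.pderiv i Y) = 0) :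
    Tendsto (fun β => (∑' x : Site 3, MvPolynomial.eval (fun i => ((x i : ℤ) : ℝ)) Y *
          Real.sqrt (∑ i, ((x i : ℤ) : ℝ) ^ 2) ^ (2 * m) * twoPointFree 3 β x) /
        (∑' x : Site 3, Real.sqrt (∑ i, ((x i : ℤ) : ℝ) ^ 2) ^ (2 + 2 * m) * twoPointFree 3 β x))
      (𝓝[<] criticalBeta 3) (𝓝 0) :=
  harmonicDilution_of_symmetrization_eq_zero 2 m Y Finset.univ_nonempty
    (symmetrization_eq_zero_of_degree_two Y hY hΔ)

/-- **`HarmonicDilution` below the first cubic harmonic (unconditional).**  The conclusion of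
`HarmonicDilution` holds for every harmonic homogeneous `Y` of degree `1 ≤ n ≤ 3` and every `m`:
degrees `1, 3` by `x ↦ -x`, degree `2` by the full hyperoctahedral average and `ΔY = 0`.  The open
content of item stmt-CriticalPhenomena-6034 therefore starts at `n = 4` (`Y = K₄`). -/
theorem harmonicDilution_of_degree_le_three (n m : ℕ) (Y : MvPolynomial (Fin 3) ℝ)
    (hn1 : 1 ≤ n) (hn3 : n ≤ 3) (hY : Y.IsHomogeneous n)
    (hΔ : ∑ i : Fin 3, MvPolynomial.pderiv i (MvPolynomial.pderiv i Y) = 0) :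
    Tendsto (fun β => (∑' x : Site 3, MvPolynomial.eval (fun i => ((x i : ℤ) : ℝ)) Y *
          Real.sqrt (∑ i, ((x i : ℤ) : ℝ) ^ 2) ^ (2 * m) * twoPointFree 3 β x) /
        (∑' x : Site 3, Real.sqrt (∑ i, ((x i : ℤ) : ℝ) ^ 2) ^ (n + 2 * m) * twoPointFree 3 β x))
      (𝓝[<] criticalBeta 3) (𝓝 0) := by
  interval_cases n
  · exact harmonicDilution_odd 1 m Y odd_one hY
  · exact harmonicDilution_of_degree_two m Y hY hΔ
  · exact harmonicDilution_odd 3 m Y (by decide) hY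

/-! ### The reduction of `HarmonicDilution` -/

/-- **Reduction of the item to the even degrees `n ≥ 4`.**  `HarmonicDilution` (route decl, item
stmt-CriticalPhenomena-6034) is equivalent to its restriction to harmonic homogeneous `Y` of even
degree `n ≥ 4` — the degrees carrying `O_h`-invariant harmonics (`K₄, K₆, …`); all other cases are
settled unconditionally above (`harmonicDilution_odd`, `harmonicDilution_of_degree_le_three`). -/
theorem harmonicDilution_iff_even_four_le :
    HarmonicDilution ↔
      ∀ (n m : ℕ) (Y : MvPolynomial (Fin 3) ℝ), 4 ≤ n → Even n → Y.IsHomogeneous n →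
        (∑ i : Fin 3, MvPolynomial.pderiv i (MvPolynomial.pderiv i Y)) = 0 →
        Tendsto (fun β => (∑' x : Site 3, MvPolynomial.eval (fun i => ((x i : ℤ) : ℝ)) Y *
              Real.sqrt (∑ i, ((x i : ℤ) : ℝ) ^ 2) ^ (2 * m) * twoPointFree 3 β x) /
            (∑' x : Site 3, Real.sqrt (∑ i, ((x i : ℤ) : ℝ) ^ 2) ^ (n + 2 * m) *
              twoPointFree 3 β x))
          (𝓝[<] criticalBeta 3) (𝓝 0) := by
  dsimp only [HarmonicDilution]
  constructor
  · intro h n m Y hn _ hY hΔ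
    exact h n m Y (by omega) hY hΔ
  · intro h n m Y hn hY hΔ
    rcases Nat.even_or_odd n with he | ho
    · by_cases h4 : 4 ≤ n
      · exact h n m Y h4 he hY hΔ
      · exact harmonicDilution_of_degree_le_three n m Y hn (by omega) hY hΔ
    · exact harmonicDilution_odd n m Y ho hY

end Summit.CriticalPhenomena.Ising3DConformalLimit.Theorems
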